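import Mathlib
import Summits.Ventures.PercRepro2.OneTypedEdge

/-!
# The root-bridge class of row 2′TRI, I: the kernel on bridge states (blind cell PercRepro2,
p3 g0, 2026-08-25; `proofs/P3-BRIDGE.md` §2, sub-claim S2.b)

A ROOT-BRIDGE instance has a typed edge `f = {a₁, v}` whose removal separates the roots; with
`o, b` on `a₁`'s side and `a₃` on `v`'s side, a copy of the support has the state
`brSt f s Lo Lb = (f ∧ hv, Lo, f ∧ hv ∧ Lo, Lb, f ∧ hv ∧ Lb, f ∧ v3, h3)` where `f` is the copy's
bit at the bridge, `s : HState` the set partition of `{a₂, v, a₃}` induced by the `h`-side with the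
bridge closed (`hv / h3 / v3` = `a₂ ↔ v`, `a₂ ↔ a₃`, `v ↔ a₃`), and `Lo / Lb` the `l`-side
connections `a₁ ↔ o`, `a₁ ↔ b`.  As a function of the six `l`-bits of the three copies the kernel
`KB` is multilinear with exactly FOUR monomials, `L_b(w)L_o(w)`, `L_b(w)L_o(y)`, `L_o(w)L_b(y)`,
`L_o(x)L_b(y)`, whose coefficients `H1 … H4` are `KB` at the four corresponding `l`-points
(`KB_brSt`: a `decide` per admissible bridge pattern, 8,000 cases each).  The symmetrisation of
`H1` over the copy order is nonnegative and the symmetrisation of `H1 + H2 + H3 + H4` vanishes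
(`sym_H1_nonneg`, `sym_sum_eq_zero`; `decide`, 1,000 cases): the whole `h`-side content of the
root-bridge theorem (`P3-BRIDGE.md` §2, the tables `φ`).  Own work; standard axioms.
-/

namespace Summit.Ventures.PercRepro2

namespace CovForm

namespace RootBridge

open OneTyped

/-- The set partition of `{a₂, v, a₃}` on the `h`-side (bridge closed): `A` all joined,
`B = {a₂ a₃ | v}`, `C = {a₂ v | a₃}`, `D = {v a₃ | a₂}`, `E` all separate. -/
inductive HState
  | A | B | C | D | E
  deriving DecidableEq, Fintype

namespace HState
/-- `a₂ ↔ v`. -/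
def hv : HState → Bool
  | A => true | B => false | C => true | D => false | E => false
/-- `a₂ ↔ a₃`. -/
def h3 : HState → Bool
  | A => true | B => true | C => false | D => false | E => false
/-- `v ↔ a₃`. -/
def v3 : HState → Bool
  | A => true | B => false | C => false | D => true | E => false
end HState

/-- The state of a copy on the support of a root-bridge instance (`o, b` on `a₁`'s side, `a₃` on
`v`'s side): bridge bit `f`, `h`-state `s`, `l`-side data `Lo, Lb`. -/
def brSt (f : Bool) (s : HState) (Lo Lb : Bool) : St :=
  (f && s.hv, Lo, f && s.hv && Lo, Lb, f && s.hv && Lb, f && s.v3, s.h3)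

/-- The coefficient of `L_b(w) L_o(w)`: `KB` with `o, b ∈ C(a₁)` in the third copy only. -/
def H1 (fx : Bool) (sx : HState) (fy : Bool) (sy : HState) (fw : Bool) (sw : HState) : ℤ :=
  KB (brSt fx sx false false) (brSt fy sy false false) (brSt fw sw true true)

/-- The coefficient of `L_b(w) L_o(y)`. -/
def H2 (fx : Bool) (sx : HState) (fy : Bool) (sy : HState) (fw : Bool) (sw : HState) : ℤ :=
  KB (brSt fx sx false false) (brSt fy sy true false) (brSt fw sw false true)

/-- The coefficient of `L_o(w) L_b(y)`. -/
def H3 (fx : Bool) (sx : HState) (fy : Bool) (sy : HState) (fw : Bool) (sw : HState) : ℤ :=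
  KB (brSt fx sx false false) (brSt fy sy false true) (brSt fw sw true false)

/-- The coefficient of `L_o(x) L_b(y)`. -/
def H4 (fx : Bool) (sx : HState) (fy : Bool) (sy : HState) (fw : Bool) (sw : HState) : ℤ :=
  KB (brSt fx sx true false) (brSt fy sy false true) (brSt fw sw false false)

/-- The four-monomial expansion (the right-hand side of `KB_brSt`). -/
def expansion (fx : Bool) (sx : HState) (Lox : Bool) (fy : Bool) (sy : HState) (Loy Lby : Bool)
    (fw : Bool) (sw : HState) (Low Lbw : Bool) : ℤ :=
  Lbw.toNat * Low.toNat * H1 fx sx fy sy fw sw + Lbw.toNat * Loy.toNat * H2 fx sx fy sy fw sw +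
    Low.toNat * Lby.toNat * H3 fx sx fy sy fw sw + Lox.toNat * Lby.toNat * H4 fx sx fy sy fw sw

/-- The expansion for the bridge pattern `(true, false, false)`. -/
theorem KB_brSt_tff (sx : HState) (Lox Lbx : Bool) (sy : HState) (Loy Lby : Bool) (sw : HState)
    (Low Lbw : Bool) :
    KB (brSt true sx Lox Lbx) (brSt false sy Loy Lby) (brSt false sw Low Lbw) =
      expansion true sx Lox false sy Loy Lby false sw Low Lbw := by
  revert sx Lox Lbx sy Loy Lby sw Low Lbw
  decide +kernel

/-- The expansion for the bridge pattern `(false, true, false)`. -/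
theorem KB_brSt_ftf (sx : HState) (Lox Lbx : Bool) (sy : HState) (Loy Lby : Bool) (sw : HState)
    (Low Lbw : Bool) :
    KB (brSt false sx Lox Lbx) (brSt true sy Loy Lby) (brSt false sw Low Lbw) =
      expansion false sx Lox true sy Loy Lby false sw Low Lbw := by
  revert sx Lox Lbx sy Loy Lby sw Low Lbw
  decide +kernel

/-- The expansion for the bridge pattern `(false, false, true)`. -/
theorem KB_brSt_fft (sx : HState) (Lox Lbx : Bool) (sy : HState) (Loy Lby : Bool) (sw : HState)
    (Low Lbw : Bool) :
    KB (brSt false sx Lox Lbx) (brSt false sy Loy Lby) (brSt true sw Low Lbw) =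
      expansion false sx Lox false sy Loy Lby true sw Low Lbw := by
  revert sx Lox Lbx sy Loy Lby sw Low Lbw
  decide +kernel

/-- The expansion for the bridge pattern `(false, true, true)`. -/
theorem KB_brSt_ftt (sx : HState) (Lox Lbx : Bool) (sy : HState) (Loy Lby : Bool) (sw : HState)
    (Low Lbw : Bool) :
    KB (brSt false sx Lox Lbx) (brSt true sy Loy Lby) (brSt true sw Low Lbw) =
      expansion false sx Lox true sy Loy Lby true sw Low Lbw := by
  revert sx Lox Lbx sy Loy Lby sw Low Lbw
  decide +kernel

/-- The expansion for the bridge pattern `(true, false, true)`. -/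
theorem KB_brSt_tft (sx : HState) (Lox Lbx : Bool) (sy : HState) (Loy Lby : Bool) (sw : HState)
    (Low Lbw : Bool) :
    KB (brSt true sx Lox Lbx) (brSt false sy Loy Lby) (brSt true sw Low Lbw) =
      expansion true sx Lox false sy Loy Lby true sw Low Lbw := by
  revert sx Lox Lbx sy Loy Lby sw Low Lbw
  decide +kernel

/-- The expansion for the bridge pattern `(true, true, false)`. -/
theorem KB_brSt_ttf (sx : HState) (Lox Lbx : Bool) (sy : HState) (Loy Lby : Bool) (sw : HState)
    (Low Lbw : Bool) :
    KB (brSt true sx Lox Lbx) (brSt true sy Loy Lby) (brSt false sw Low Lbw) =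
      expansion true sx Lox true sy Loy Lby false sw Low Lbw := by
  revert sx Lox Lbx sy Loy Lby sw Low Lbw
  decide +kernel

/-- An admissible bridge pattern: one or two open copies. -/
def Adm (fx fy fw : Bool) : Prop :=
  fx.toNat + fy.toNat + fw.toNat = 1 ∨ fx.toNat + fy.toNat + fw.toNat = 2

/-- Admissibility is decidable. -/
instance (fx fy fw : Bool) : Decidable (Adm fx fy fw) := by unfold Adm; infer_instance

/-- **The kernel on bridge states** is multilinear in the six `l`-bits with the four monomials
`L_b(w)L_o(w)`, `L_b(w)L_o(y)`, `L_o(w)L_b(y)`, `L_o(x)L_b(y)` and coefficients `H1 … H4`, for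
every admissible bridge pattern. -/
theorem KB_brSt (fx : Bool) (sx : HState) (Lox Lbx : Bool) (fy : Bool) (sy : HState) (Loy Lby : Bool)
    (fw : Bool) (sw : HState) (Low Lbw : Bool) (hadm : Adm fx fy fw) :
    KB (brSt fx sx Lox Lbx) (brSt fy sy Loy Lby) (brSt fw sw Low Lbw) =
      expansion fx sx Lox fy sy Loy Lby fw sw Low Lbw := by
  cases fx <;> cases fy <;> cases fw
  · simp [Adm] at hadm
  · exact KB_brSt_fft sx Lox Lbx sy Loy Lby sw Low Lbw
  · exact KB_brSt_ftf sx Lox Lbx sy Loy Lby sw Low Lbw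
  · exact KB_brSt_ftt sx Lox Lbx sy Loy Lby sw Low Lbw
  · exact KB_brSt_tff sx Lox Lbx sy Loy Lby sw Low Lbw
  · exact KB_brSt_tft sx Lox Lbx sy Loy Lby sw Low Lbw
  · exact KB_brSt_ttf sx Lox Lbx sy Loy Lby sw Low Lbw
  · simp [Adm] at hadm

/-- The `S₃`-symmetrisation of an `h`-coefficient over the copy order. -/
def symH (H : Bool → HState → Bool → HState → Bool → HState → ℤ)
    (fx : Bool) (sx : HState) (fy : Bool) (sy : HState) (fw : Bool) (sw : HState) : ℤ :=
  H fx sx fy sy fw sw + H fx sx fw sw fy sy + H fy sy fx sx fw sw + H fy sy fw sw fx sx +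
    H fw sw fx sx fy sy + H fw sw fy sy fx sx

/-- **The symmetrised `L_b L_o`-coefficient is nonnegative** for every admissible bridge pattern
(the tables `φ` of `P3-BRIDGE.md` §2). -/
theorem sym_H1_nonneg (fx : Bool) (sx : HState) (fy : Bool) (sy : HState) (fw : Bool)
    (sw : HState) (hadm : Adm fx fy fw) : 0 ≤ symH H1 fx sx fy sy fw sw := by
  revert fx sx fy sy fw sw
  decide +kernel

/-- The four coefficients sum to zero after symmetrisation: the cross terms pay exactly the
same-copy term (`Φ_B = −Φ_A`). -/
theorem sym_sum_eq_zero (fx : Bool) (sx : HState) (fy : Bool) (sy : HState) (fw : Bool)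
    (sw : HState) (hadm : Adm fx fy fw) :
    symH H1 fx sx fy sy fw sw + symH H2 fx sx fy sy fw sw + symH H3 fx sx fy sy fw sw +
      symH H4 fx sx fy sy fw sw = 0 := by
  revert fx sx fy sy fw sw
  decide +kernel

end RootBridge

end CovForm

end Summit.Ventures.PercRepro2
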